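import Summits.AtomisticToContinuum.BoseEinsteinCondensation.Theorems.PeriodicToDirichlet.Negative.RewardedFreeGasCap
import Summits.AtomisticToContinuum.BoseEinsteinCondensation.Theorems.PeriodicToDirichlet.Negative.RewardedFreeGasPlateau

/-!
# Negative lemmas for crux `PeriodicToDirichlet` (stmt-AtomisticToContinuum-9483), rewarded free gas IV:
at `v = 0` the rewarded anchors hold for every `c < 1`; `Unrewarding` cannot keep its constant

Supports (does not close) stmt-AtomisticToContinuum-9483 (crux `PeriodicToDirichlet`, route
`BECThomsonPrinciple`), line `reward-pays-the-wall`, stub `Unrewarding` (skeleton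
`Cruxes/PeriodicToDirichlet/Lines/reward-pays-the-wall.lean`, not an importable module: its
reward vocabulary is copied verbatim in part II). Filed by the crux disprover (gen 3). Series:
I `RewardedFreeGasSlab` (translation/slab/one-body flat overlap) and III `RewardedFreeGasPlateau`
(plateau modes) are independent; II `RewardedFreeGasCap` (flat mode, `N`-body bound, the cap
`flatCap < 1` at `λ = 0`, reward vocabulary) imports I; IV `RewardedFreeGasAnchors` (rewarded
anchors for every `c < 1` at `v = 0`; `¬ UnrewardingSameConstant`) imports II and III.

This part (all `[folklore]`, sorry-free):
* `plateauPow`, `plateauBox` — `u_η^{⊗N}` in the unit cube and dilated to `Λ_L`: free energy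
  `N𝓔₀[u_η]/L²` (`energy_plateauBox`), flat occupation `≥ N(1−4η)⁶` (`occupation_plateauBox_ge`,
  via `occupation_powFun_succ`, `dilateMode_flatMode`, `occupation_dilate`);
* `rewardedBoxBECAt_zero_of_lt_one` — **at `v = 0` the anchors `RewardedBoxBECAt 0 ρ λ c` hold for
  EVERY `c < 1`, EVERY `λ > 0`, EVERY `ρ > 0`**, with no torus hypothesis: the rewarded flat
  fraction of the free Dirichlet near-minimisers tends to `1` (`R_λ ≥ λ(N − n_φ)` against the
  plateau trial value `N𝓔₀[u_η]/L² + λN(1 − (1−4η)⁶)`);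
* `not_unrewardingSameConstant : ¬ UnrewardingSameConstant`, `exists_anchors_without_unrewarded_bec`
  — stub 4 CANNOT keep its constant: the flat fraction of the free Dirichlet gas JUMPS at `λ = 0⁺`
  in the thermodynamic limit (`1` versus `≤ flatCap < 1`, in truth `0.5326`), i.e. the
  susceptibility `χ_N = dn_φ/dλ` is not uniformly-in-`N` integrable at `0⁺` (all of
  `∫₀^{λ₁}χ_N ≳ (1 − flatCap)N` sits at `λ ≲ L_N⁻²`). Any proof of `Unrewarding` must lose an
  `O(1)` factor at `a = 0` or use `a > 0` essentially; `Unrewarding` itself (`∃ c' > 0`) is NOT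
  refuted (`unrewarding_of_sameConstant` records only the trivial direction).
-/

noncomputable section

open MeasureTheory Filter Set Metric
open scoped ENNReal NNReal ComplexConjugate Topology

namespace Summit.AtomisticToContinuum.BoseEinsteinCondensation.Theorems.PeriodicToDirichlet.Negative

open Literature.MathematicalPhysics.QuantumManyBody.BoseGas

section PlateauStates

variable {η : ℝ} (hη : 0 < η) (hη4 : η < 1 / 4)

/-- **The plateau power state** `u^{⊗N}` in the unit cube (a Dirichlet trial state). [folklore] -/
def plateauPow (N : ℕ) : TrialState N 1 where
  ψ := powFun (plateauMode hη hη4) N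
  contDiff := contDiff_powFun (contDiff_oneFun_plateauMode hη hη4) N
  eq_zero X hX := by
    have : ∃ i, X i ∉ box 1 := by simpa [boxN] using hX
    obtain ⟨i, hi⟩ := this
    exact powFun_eq_zero_of_exists _ ⟨i, plateauMode_eq_zero hη hη4 hi⟩
  symm σ X := powFun_comp_perm _ σ X
  norm_eq := lintegral_powFun_sq (contDiff_oneFun_plateauMode hη hη4)
    (lintegral_oneFun_plateauMode_sq hη hη4) N

/-- The wave function of the plateau power state. [folklore] -/
@[simp] theorem plateauPow_ψ (N : ℕ) :
    (plateauPow hη hη4 N).ψ = powFun (plateauMode hη hη4) N := rfl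

/-- Its free energy is `N` times the one-body energy `𝓔₀[u]`. [folklore] -/
theorem energy_plateauPow (N : ℕ) :
    energy 0 (plateauPow hη hη4 N) = N * rawEnergy 0 (oneFun (plateauMode hη hη4)) := by
  rw [energy_eq_rawEnergy]
  exact rawEnergy_zero_powFun (contDiff_oneFun_plateauMode hη hη4)
    (lintegral_oneFun_plateauMode_sq hη hη4) N

/-- The one-body energy `𝓔₀[u]` is finite. [folklore] -/
theorem rawEnergy_plateauMode_ne_top : rawEnergy 0 (oneFun (plateauMode hη hη4)) ≠ ⊤ := by
  have h := energy_zero_lt_top (plateauPow hη hη4 1)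
  rw [energy_plateauPow] at h
  simpa using h.ne

/-- **Occupation of a mode in a product state**: `⟨φ, γ_{u^{⊗N}} φ⟩ = N |⟨φ, u⟩|²`. [folklore] -/
theorem occupation_powFun_succ (φ : Space → ℂ) (n : ℕ) :
    occupation (n + 1) φ (powFun (plateauMode hη hη4) (n + 1)) =
      (n + 1 : ℝ≥0∞) * (‖∫ x, conj (φ x) * plateauMode hη hη4 x‖₊ : ℝ≥0∞) ^ 2 := by
  unfold occupation
  push_cast
  congr 1
  have hY : ∀ Y : Config n, ∫ x, conj (φ x) * powFun (plateauMode hη hη4) (n + 1) (Matrix.vecCons x Y) =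
      (∫ x, conj (φ x) * plateauMode hη hη4 x) * powFun (plateauMode hη hη4) n Y := by
    intro Y
    simp_rw [powFun_vecCons]
    rw [← integral_mul_const]
    congr 1
    funext x
    ring
  simp_rw [hY, nnnorm_mul, ENNReal.coe_mul, mul_pow]
  rw [lintegral_const_mul' _ _ (ENNReal.pow_ne_top ENNReal.coe_ne_top),
    lintegral_powFun_sq (contDiff_oneFun_plateauMode hη hη4) (lintegral_oneFun_plateauMode_sq hη hη4) n,
    mul_one]

/-- Dilating the flat mode of the unit cube gives the flat mode of `Λ_L`. [folklore] -/
theorem dilateMode_flatMode {L : ℝ} (hL : 0 < L) : dilateMode L (flatMode 1) = flatMode L := by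
  funext x
  have hiff : x ∈ box L ↔ L⁻¹ • x ∈ box 1 := by
    have := mem_box_smul_iff hL 1 x
    rwa [mul_one] at this
  simp only [dilateMode, flatMode, boxConstantMode, dilationConst, pow_one]
  by_cases hx : x ∈ box L
  · rw [Set.indicator_of_mem hx, Set.indicator_of_mem (hiff.1 hx)]
    simp
  · rw [Set.indicator_of_notMem hx, Set.indicator_of_notMem (fun h => hx (hiff.2 h))]
    simp

/-- **The plateau state of the box `Λ_L`**: the dilated power state. [folklore] -/
def plateauBox (N : ℕ) {L : ℝ} (hL : 0 < L) : TrialState N L :=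
  ((plateauPow hη hη4 N).dilate hL).castLen (mul_one L)

/-- Its free energy is `N 𝓔₀[u] / L²`. [folklore] -/
theorem energy_plateauBox (N : ℕ) {L : ℝ} (hL : 0 < L) :
    energy 0 (plateauBox hη hη4 N hL) =
      ENNReal.ofReal (L ^ 2)⁻¹ * (N * rawEnergy 0 (oneFun (plateauMode hη hη4))) := by
  rw [plateauBox, TrialState.energy_castLen]
  have h := TrialState.energy_dilate 0 (plateauPow hη hη4 N) hL
  rw [scalePotential_zero] at h
  rw [h, energy_plateauPow]

/-- **Its flat-mode occupation is that of `u^{⊗N}` against the unit flat mode**: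
`n_φ = N |⟨φ₁, u⟩|² ≥ N (1 − 4η)⁶`. [folklore] -/
theorem occupation_plateauBox_ge (n : ℕ) {L : ℝ} (hL : 0 < L) :
    ENNReal.ofReal ((n + 1) * (1 - 4 * η) ^ 6) ≤
      occupation (n + 1) (flatMode L) (plateauBox hη hη4 (n + 1) hL).ψ := by
  have hbox : ∫ x, conj (flatMode 1 x) * plateauMode hη hη4 x = ∫ x, plateauMode hη hη4 x := by
    rw [integral_conj_flatMode_mul,
      setIntegral_eq_integral_of_forall_compl_eq_zero fun x hx => plateauMode_eq_zero hη hη4 hx]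
    simp
  rw [plateauBox, TrialState.castLen_ψ, TrialState.dilate_ψ_eq_dilateFun, ← dilateMode_flatMode hL,
    occupation_dilate hL, plateauPow_ψ, occupation_powFun_succ, hbox,
    ENNReal.ofReal_mul (by positivity), show ENNReal.ofReal (n + 1) = (n + 1 : ℝ≥0∞) by
      rw [← Nat.cast_succ (R := ℝ), ENNReal.ofReal_natCast, Nat.cast_succ]]
  gcongr
  exact integral_plateauMode_sq_ge hη hη4

end PlateauStates

/-- **At `v = 0` the rewarded anchors hold for EVERY `c < 1` at EVERY reward `λ > 0`** — the
hypothesis of stub 4 (`∀ λ > 0, RewardedBoxBECAt 0 ρ λ c`) is FREE for the free gas, with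
constant arbitrarily close to `1`, and needs no torus input `A`: the plateau state has
`R_λ ≤ N𝓔₀[u_η]/L² + λN(1 − (1−4η)⁶)`, while `R_λ(Ψ) ≥ λ(N − n_φ(Ψ))` for every `Ψ`.
So the rewarded flat fraction of the free Dirichlet near-minimisers tends to `1` as `N → ∞` at
every fixed `λ > 0`. [folklore] -/
theorem rewardedBoxBECAt_zero_of_lt_one {ρ c lam : ℝ} (hρ : 0 < ρ) (hc : c < 1) (hlam : 0 < lam) :
    RewardedBoxBECAt 0 ρ lam c := by
  by_cases hc0 : c ≤ 0
  · refine Eventually.of_forall fun N => ⟨1, one_pos, fun Ψ _ => ?_⟩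
    rw [ENNReal.ofReal_of_nonpos (mul_nonpos_of_nonpos_of_nonneg hc0 N.cast_nonneg)]
    exact bot_le
  replace hc0 : 0 < c := not_le.1 hc0
  -- the plateau parameter
  set η : ℝ := (1 - c) / 48 with hηdef
  have hη : 0 < η := by rw [hηdef]; linarith
  have hη4 : η < 1 / 4 := by rw [hηdef]; linarith
  have hbern : (1 + c) / 2 ≤ (1 - 4 * η) ^ 6 := by
    have h := one_add_mul_le_pow (show (-2 : ℝ) ≤ -(4 * η) by linarith) 6
    have : (1 : ℝ) + (6 : ℕ) * -(4 * η) = (1 + c) / 2 := by rw [hηdef]; push_cast; ring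
    rw [this] at h
    simpa [sub_eq_add_neg] using h
  -- the one-body energy of the plateau mode
  set K : ℝ≥0∞ := rawEnergy 0 (oneFun (plateauMode hη hη4)) with hK
  have hKtop : K ≠ ⊤ := rawEnergy_plateauMode_ne_top hη hη4
  set Kr : ℝ := K.toReal with hKr
  have hKeq : K = ENNReal.ofReal Kr := (ENNReal.ofReal_toReal hKtop).symm
  have hKr0 : 0 ≤ Kr := ENNReal.toReal_nonneg
  -- large `N`
  set M : ℝ := max 1 (4 * Kr / (lam * (1 - c)) + 1) with hM
  have h1c : 0 < 1 - c := by linarith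
  filter_upwards [(tendsto_sideLength_atTop hρ).eventually_ge_atTop M, eventually_gt_atTop 0]
    with N hNM hN
  obtain ⟨n, rfl⟩ : ∃ n, N = n + 1 := ⟨N - 1, by omega⟩
  set L := sideLength ρ (n + 1) with hL
  have hL0 : 0 < L := sideLength_pos_of_pos hρ hN
  have hL1 : 1 ≤ L := (le_max_left _ _).trans hNM
  have hLK : Kr / L ^ 2 ≤ lam * (1 - c) / 4 := by
    have h2 : 4 * Kr / (lam * (1 - c)) + 1 ≤ L := (le_max_right _ _).trans hNM
    have h3 : L ≤ L ^ 2 := by nlinarith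
    rw [div_le_iff₀ (by positivity)]
    have h4 : 4 * Kr / (lam * (1 - c)) ≤ L ^ 2 := by linarith
    rw [div_le_iff₀ (by positivity)] at h4
    nlinarith
  have hNpos : (0 : ℝ) < n + 1 := by positivity
  -- the slack
  refine ⟨ENNReal.ofReal (lam * (n + 1) * (1 - c) / 4), by rw [ENNReal.ofReal_pos]; positivity,
    fun Ψ hΨ => ?_⟩
  set Φ := plateauBox hη hη4 (n + 1) hL0 with hΦ
  -- energy and occupation of the plateau state
  have hEΦ : energy 0 Φ ≤ ENNReal.ofReal (lam * (n + 1) * (1 - c) / 4) := by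
    rw [hΦ, energy_plateauBox, ← hK, hKeq, show ((n + 1 : ℕ) : ℝ≥0∞) = ENNReal.ofReal (n + 1) by
        rw [← Nat.cast_succ (R := ℝ), ENNReal.ofReal_natCast],
      ← ENNReal.ofReal_mul (by positivity), ENNReal.ofReal_inv_of_pos (by positivity),
      ← ENNReal.div_eq_inv_mul, ← ENNReal.ofReal_div_of_pos (by positivity)]
    refine ENNReal.ofReal_le_ofReal ?_
    rw [div_le_iff₀ (by positivity)]
    rw [div_le_iff₀ (by positivity)] at hLK
    nlinarith
  have hoccΦ : ENNReal.ofReal ((n + 1) * ((1 + c) / 2)) ≤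
      occupation (n + 1) (flatMode L) Φ.ψ := by
    refine le_trans (ENNReal.ofReal_le_ofReal ?_) (occupation_plateauBox_ge hη hη4 n hL0)
    exact mul_le_mul_of_nonneg_left hbern hNpos.le
  -- the reward sandwich: `λ(N − n_φ(Ψ)) ≤ R_λ(Ψ) ≤ R_λ(Φ) + δ`
  have hcast : ((n + 1 : ℕ) : ℝ≥0∞) = ENNReal.ofReal (n + 1) := by
    rw [← Nat.cast_succ (R := ℝ), ENNReal.ofReal_natCast]
  have hsub : ((n + 1 : ℕ) : ℝ≥0∞) - occupation (n + 1) (flatMode L) Φ.ψ ≤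
      ENNReal.ofReal ((n + 1) * (1 - c) / 2) := by
    calc ((n + 1 : ℕ) : ℝ≥0∞) - occupation (n + 1) (flatMode L) Φ.ψ
        ≤ ENNReal.ofReal (n + 1) - ENNReal.ofReal ((n + 1) * ((1 + c) / 2)) := by
          rw [hcast]; exact tsub_le_tsub_left hoccΦ _
      _ = ENNReal.ofReal ((n + 1) * (1 - c) / 2) := by
          rw [← ENNReal.ofReal_sub _ (by positivity)]
          congr 1; ring
  have hchain : ENNReal.ofReal lam * (((n + 1 : ℕ) : ℝ≥0∞) - occupation (n + 1) (flatMode L) Ψ.ψ) ≤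
      ENNReal.ofReal lam * ENNReal.ofReal ((n + 1) * (1 - c)) := by
    calc ENNReal.ofReal lam * (((n + 1 : ℕ) : ℝ≥0∞) - occupation (n + 1) (flatMode L) Ψ.ψ)
        ≤ rewardedEnergy 0 lam Ψ := le_add_self
      _ ≤ rewardedInf 0 lam (n + 1) L + ENNReal.ofReal (lam * (n + 1) * (1 - c) / 4) := hΨ
      _ ≤ rewardedEnergy 0 lam Φ + ENNReal.ofReal (lam * (n + 1) * (1 - c) / 4) :=
          add_le_add (iInf_le _ Φ) le_rfl
      _ ≤ ENNReal.ofReal (lam * (n + 1) * (1 - c) / 4) +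
            ENNReal.ofReal lam * ENNReal.ofReal ((n + 1) * (1 - c) / 2) +
            ENNReal.ofReal (lam * (n + 1) * (1 - c) / 4) := by
          unfold rewardedEnergy
          gcongr
      _ = ENNReal.ofReal lam * ENNReal.ofReal ((n + 1) * (1 - c)) := by
          rw [← ENNReal.ofReal_mul hlam.le, ← ENNReal.ofReal_add (by positivity) (by positivity),
            ← ENNReal.ofReal_add (by positivity) (by positivity), ← ENNReal.ofReal_mul hlam.le]
          congr 1; ring
  have hlam0 : ENNReal.ofReal lam ≠ 0 := by rwa [Ne, ENNReal.ofReal_eq_zero, not_le]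
  have hcancel : ((n + 1 : ℕ) : ℝ≥0∞) - occupation (n + 1) (flatMode L) Ψ.ψ ≤
      ENNReal.ofReal ((n + 1) * (1 - c)) :=
    (ENNReal.mul_le_mul_iff_right hlam0 ENNReal.ofReal_ne_top).1 hchain
  rw [tsub_le_iff_right, hcast] at hcancel
  -- `N = cN + (1 − c)N`
  have hsplit : ENNReal.ofReal (n + 1) = ENNReal.ofReal (c * (n + 1 : ℕ)) +
      ENNReal.ofReal ((n + 1) * (1 - c)) := by
    rw [← ENNReal.ofReal_add (by push_cast; positivity) (by positivity)]
    congr 1; push_cast; ring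
  rw [hsplit, add_comm (ENNReal.ofReal (c * _)), ] at hcancel
  exact (ENNReal.add_le_add_iff_left ENNReal.ofReal_ne_top).1 hcancel

/-! ## §6 Consequences for stub 4 of line `reward-pays-the-wall` -/

/-- **`Unrewarding` cannot keep the constant.** The natural strengthening of stub 4 in which
un-rewarding preserves the constant (`c' = c`) is FALSE — witness the free gas: for any `c` with
`flatCap < c < 1` the rewarded anchors hold at every `λ > 0` (`rewardedBoxBECAt_zero_of_lt_one`)
while flat-mode BEC with constant `c ≥ flatCap` fails at `λ = 0`
(`not_rewardedBoxBECAt_zero_flatCap`). Physically: the flat fraction of the free Dirichlet gas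
JUMPS at `λ = 0⁺` in the thermodynamic limit (`lim_{λ↓0} lim_N n_φ/N = 1 > (8/π²)³ = lim_N n_φ/N`
at `λ = 0`), i.e. the susceptibility `χ_N = dn_φ/dλ` is NOT uniformly integrable at `0⁺` — all of
`∫₀^{λ₁} χ_N ≈ 0.47N` sits at `λ ≲ L_N⁻²`. Any proof of stub 4 must lose an `O(1)` factor in the
constant at `a = 0`, or use `a > 0` in an essential way. [folklore] -/
theorem not_unrewardingSameConstant : ¬ UnrewardingSameConstant := by
  intro h
  obtain ⟨ρ₃, hρ₃, H⟩ := h 0 ⟨measurable_const, 0, fun _ _ => rfl⟩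
  set ρ : ℝ := ρ₃ / 2 with hρ
  have hρ0 : 0 < ρ := by positivity
  have hρlt : ρ < ρ₃ := by rw [hρ]; linarith
  set c : ℝ := max ((flatCap + 1) / 2) (1 / 2) with hc
  have hc1 : c < 1 := max_lt (by linarith [flatCap_lt_one]) (by norm_num)
  have hc0 : 0 < c := lt_of_lt_of_le (by norm_num) (le_max_right _ _)
  have hcap : flatCap ≤ c := le_trans (by linarith [flatCap_lt_one]) (le_max_left _ _)
  have hanchors : ∀ lam : ℝ, 0 < lam → RewardedBoxBECAt 0 ρ lam c :=
    fun lam hlam => rewardedBoxBECAt_zero_of_lt_one hρ0 hc1 hlam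
  have h0 : RewardedBoxBECAt 0 ρ 0 c := H ρ hρ0 hρlt c hc0 hanchors
  -- monotonicity in the constant brings it down to `flatCap`
  have hmono : RewardedBoxBECAt 0 ρ 0 flatCap := by
    refine h0.mono fun N ⟨δ, hδ, hΨ⟩ => ⟨δ, hδ, fun Ψ hE => le_trans ?_ (hΨ Ψ hE)⟩
    exact ENNReal.ofReal_le_ofReal (mul_le_mul_of_nonneg_right hcap N.cast_nonneg)
  exact not_rewardedBoxBECAt_zero_flatCap hρ0 hmono

/-- The same fact in the shape provers quote: **no admissible constant-keeping un-rewarding at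
ANY density for the free gas** — for every `ρ > 0` there is `c ∈ (0,1)` with all anchors and no
unrewarded flat-mode BEC at constant `c`. [folklore] -/
theorem exists_anchors_without_unrewarded_bec {ρ : ℝ} (hρ : 0 < ρ) :
    ∃ c : ℝ, 0 < c ∧ c < 1 ∧ (∀ lam : ℝ, 0 < lam → RewardedBoxBECAt 0 ρ lam c) ∧
      ¬ RewardedBoxBECAt 0 ρ 0 c := by
  set c : ℝ := max ((flatCap + 1) / 2) (1 / 2) with hc
  have hc1 : c < 1 := max_lt (by linarith [flatCap_lt_one]) (by norm_num)
  have hc0 : 0 < c := lt_of_lt_of_le (by norm_num) (le_max_right _ _)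
  have hcap : flatCap ≤ c := le_trans (by linarith [flatCap_lt_one]) (le_max_left _ _)
  refine ⟨c, hc0, hc1, fun lam hlam => rewardedBoxBECAt_zero_of_lt_one hρ hc1 hlam, fun h0 => ?_⟩
  have hmono : RewardedBoxBECAt 0 ρ 0 flatCap := by
    refine h0.mono fun N ⟨δ, hδ, hΨ⟩ => ⟨δ, hδ, fun Ψ hE => le_trans ?_ (hΨ Ψ hE)⟩
    exact ENNReal.ofReal_le_ofReal (mul_le_mul_of_nonneg_right hcap N.cast_nonneg)
  exact not_rewardedBoxBECAt_zero_flatCap hρ hmono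

/-- **Stub 4 itself survives at `v = 0`** only through the existential `∃ c' > 0`: nothing here
refutes `Unrewarding` (its `¬` would need the failure of flat-mode BEC of the dilute Dirichlet
gas for some admissible `v`, which is open). Recorded as the trivial implication from the
constant-keeping version. [folklore] -/
theorem unrewarding_of_sameConstant (h : UnrewardingSameConstant) : Unrewarding := by
  intro v hv
  obtain ⟨ρ₃, hρ₃, H⟩ := h v hv
  exact ⟨ρ₃, hρ₃, fun ρ hρ hlt c hc hA => ⟨c, hc, H ρ hρ hlt c hc hA⟩⟩

end Summit.AtomisticToContinuum.BoseEinsteinCondensation.Theorems.PeriodicToDirichlet.Negative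

end
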